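import Literature.Probability.RandomPlanarGeometry.FaceGreenFunction
import Literature.MathematicalPhysics.QuantumFieldTheory.GaussianToolkit
import HarnessLib

/-!
# The face DGFF is the centred Gaussian law of covariance `faceGreen`

Companion to `FaceDGFF.lean` (definitions, request `defn-faceDGFF` of route
`CriticalPhenomena/SAWScalingLimit/SAWDiscreteFlowLine`) and `FaceGreenFunction.lean` (the Green
matrix `G = faceGreenMatrix S = (I − P_S)⁻¹`, positive definite). `FaceDGFF.lean` defines the
zero-boundary discrete Gaussian free field on the faces `Fc = faceDomain Ω δ` of `Ω_δ` as the law

  `faceDGFF Ω δ = (Z⁻¹ e^{−½ Q(h)} dh on ℝ^{Fc}) ∘ (extension by zero)⁻¹`,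
  `Q = facePrecisionForm` (the Dirichlet form of the killed walk),

(junk `δ_0` when `Fc` is infinite) and the predicate `IsFaceDGFFLaw Ω δ μ` — the clause `gff δ μ` of
the three cruxes of the route: `μ` is a probability measure with
`∫ e^{i Σ_f t_f h_f} dμ = e^{−½ Σ_{f,g} t_f t_g G_{Fc}(f,g)}` for finitely supported `t` — and defers
the proofs relating the two. They are given here (Schramm–Sheffield 2009, §1.3: the DGFF is the
centred Gaussian whose covariance is the Green function of the killed walk; Sheffield 2007, §2):

* `facePrecisionForm_extendByZero` — `Q(h) = hᵀ(I − P_S)h` (reindexing unit steps ↔ adjacent faces);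
* `faceDGFF_eq_map_multivariateGaussian` — **`faceDGFF Ω δ = (multivariateGaussian 0 G) ∘ ext⁻¹`**
  with Mathlib's `ProbabilityTheory.multivariateGaussian` on Euclidean `ℝ^{Fc}` (via the tree's
  `GaussianToolkit.multivariateGaussian_inv_eq_withDensity`: `N(0, P⁻¹) = Z_P⁻¹ e^{−½ yᵀPy} dy` for
  positive definite `P`, here `P = I − P_S`, `P⁻¹ = G` by `faceGreenMatrix_eq_inv`);
* `faceDomain_finite` — `Fc` is finite for bounded `Ω` and `δ > 0` (the standing hypothesis below);
* consequences: `isProbabilityMeasure_faceDGFF` (all `Ω, δ`), `faceDGFF_eval_ne_zero` (the field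
  vanishes off `Fc`), `integral_eval_faceDGFF` (centred), `integral_mul_eval_faceDGFF`
  (**`E[h_f h_g] = G_{Fc}(f,g)`**, Mathlib `covariance_eval_multivariateGaussian`),
  `sum_sum_faceGreen_nonneg` (the covariance form is positive semidefinite), and
  **`isFaceDGFFLaw_faceDGFF`**: for finite `Fc` (e.g. `Ω` bounded, `δ > 0`),
  `IsFaceDGFFLaw Ω δ (faceDGFF Ω δ)` (Mathlib `charFun_multivariateGaussian`), so the hypothesis
  `gff δ (P δ)` of the cruxes `LatticeFlowLine` / `FlowLineStability` / `GaussianDressing` is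
  satisfiable;
* uniqueness: `measure_eq_of_integral_exp_sum_eq` (finite-dimensional characteristic functionals
  determine a finite measure on `ℝ^{ℤ²}`: Mathlib `Measure.ext_of_charFun` on each Euclidean `ℝ^J`
  plus `IsProjectiveLimit.unique`) and **`isFaceDGFFLaw_iff`**: for finite `Fc`,
  `IsFaceDGFFLaw Ω δ μ ↔ μ = faceDGFF Ω δ` — the `gff` hypothesis pins `P δ` down.

Theorems only; no definition and no named fact is introduced. Not here: the domain Markov property
(conditioning on the values on a face set gives the face DGFF of the complement plus the discrete
harmonic extension, Schramm–Sheffield 2009 §1.2).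

## References

* O. Schramm, S. Sheffield, *Contour lines of the two-dimensional discrete Gaussian free field*,
  Acta Math. 202 (2009), §1.3. [SchrammSheffield2009]
* G. F. Lawler, *Intersections of Random Walks*, Birkhäuser 1991, §1.5 (Green's function of the killed
  walk). [Lawler1991]
-/

noncomputable section

open MeasureTheory ProbabilityTheory Matrix Finset WithLp
open scoped ENNReal Classical

namespace Literature.Probability.RandomPlanarGeometry

open Literature.Probability.LatticeModels
open Literature.MathematicalPhysics.QuantumFieldTheory.GaussianToolkit

variable (S : Finset (Site 2))

/-! ### Finiteness of the face domain -/

/-- Faces of `Ω_δ` are vertices of `Ω_δ` (their lower-left corner is an endpoint of an edge of the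
discrete domain graph). [folklore] -/
theorem faceDomain_subset_meshDomain (Ω : Set ℂ) (δ : ℝ) : faceDomain Ω δ ⊆ meshDomain Ω δ :=
  fun _ hf => (discreteDomainGraph_adj_iff.1 hf.1).2.1

/-- **For a bounded domain and a positive mesh the face domain is finite** — the hypothesis under
which `faceDGFF` is the genuine Gaussian law (all theorems below). [folklore] -/
theorem faceDomain_finite {Ω : Set ℂ} {δ : ℝ} (hΩ : Bornology.IsBounded Ω) (hδ : 0 < δ) :
    (faceDomain Ω δ).Finite :=
  (meshDomain_finite hΩ hδ).subset (faceDomain_subset_meshDomain Ω δ)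

/-! ### The Dirichlet form: `facePrecisionForm S = hᵀ (I − P_S) h` -/

/-- Adjacency in `ℤ²` through the four unit steps `unitSteps = {±e₀, ±e₁}`. [folklore] -/
theorem zdGraph_two_adj_iff_exists_unitSteps (a z : Site 2) :
    (zdGraph 2).Adj a z ↔ ∃ e ∈ unitSteps, z = a + e := by
  have h0 : (Pi.single 0 1 : Site 2) = ![1, 0] := by ext j; fin_cases j <;> rfl
  have h1 : (Pi.single 1 1 : Site 2) = ![0, 1] := by ext j; fin_cases j <;> rfl
  rw [zdGraph_adj_iff]
  simp only [unitSteps, Finset.mem_insert, Finset.mem_singleton, exists_eq_or_imp, exists_eq_left,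
    Fin.exists_fin_two, h0, h1]
  constructor
  · rintro (⟨h | h⟩ | ⟨h | h⟩)
    · exact Or.inl h
    · refine Or.inr (Or.inl ?_)
      rw [h]; ext j; fin_cases j <;> simp <;> rfl
    · exact Or.inr (Or.inr (Or.inl h))
    · refine Or.inr (Or.inr (Or.inr ?_))
      rw [h]; ext j; fin_cases j <;> simp <;> rfl
  · rintro (h | h | h | h)
    · exact Or.inl (Or.inl h)
    · refine Or.inl (Or.inr ?_)
      rw [h]; ext j; fin_cases j <;> simp <;> rfl
    · exact Or.inr (Or.inl h)
    · refine Or.inr (Or.inr ?_)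
      rw [h]; ext j; fin_cases j <;> simp <;> rfl

/-- `extendByZero` at a point of `S`. [folklore] -/
theorem extendByZero_apply_of_mem {S : Finset (Site 2)} (x : S → ℝ) {f : Site 2} (hf : f ∈ S) :
    extendByZero S x f = x ⟨f, hf⟩ :=
  extendByZero_apply_mem x ⟨f, hf⟩

/-- Reindexing the nearest-neighbour coupling of `facePrecisionForm` from unit steps to the faces of
`S` adjacent to a given face. [folklore] -/
theorem sum_unitSteps_eq_sum_ite (x : S → ℝ) (i : S) :
    ∑ e ∈ unitSteps, (if (i : Site 2) + e ∈ S then x i * extendByZero S x ((i : Site 2) + e) else 0) =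
      ∑ j : S, if (zdGraph 2).Adj (i : Site 2) j then x i * x j else 0 := by
  rw [← Finset.sum_filter, ← Finset.sum_filter]
  refine Finset.sum_bij' (fun e he => ⟨(i : Site 2) + e, (Finset.mem_filter.1 he).2⟩)
    (fun j _ => (j : Site 2) - i) ?_ ?_ ?_ ?_ ?_
  · intro e he
    rw [Finset.mem_filter] at he ⊢
    exact ⟨Finset.mem_univ _, (zdGraph_two_adj_iff_exists_unitSteps _ _).2 ⟨e, he.1, rfl⟩⟩
  · intro j hj
    rw [Finset.mem_filter] at hj ⊢
    obtain ⟨e, he, hje⟩ := (zdGraph_two_adj_iff_exists_unitSteps _ _).1 hj.2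
    refine ⟨by rw [hje, add_sub_cancel_left]; exact he, ?_⟩
    rw [add_sub_cancel]
    exact j.2
  · intro e he
    exact add_sub_cancel_left _ _
  · intro j hj
    exact Subtype.ext (add_sub_cancel _ _)
  · intro e he
    rw [Finset.mem_filter] at he
    rw [extendByZero_apply_of_mem x he.2]

/-- **The Dirichlet form of the killed walk is the quadratic form of `I − P_S`**:
`facePrecisionForm S (extendByZero S x) = xᵀ (I − P_S) x`. [folklore] -/
theorem facePrecisionForm_extendByZero (x : S → ℝ) :
    facePrecisionForm S (extendByZero S x) = x ⬝ᵥ (1 - faceTransition S) *ᵥ x := by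
  have hR : ∀ i : S, x i * ∑ j, faceTransition S i j * x j =
      4⁻¹ * ∑ j : S, (if (zdGraph 2).Adj (i : Site 2) j then x i * x j else 0) := by
    intro i
    rw [Finset.mul_sum, Finset.mul_sum]
    refine Finset.sum_congr rfl fun j _ => ?_
    rw [faceTransition_apply]
    split_ifs <;> ring
  have h2 : x ⬝ᵥ faceTransition S *ᵥ x = ∑ i, x i * ∑ j, faceTransition S i j * x j := rfl
  rw [Matrix.sub_mulVec, Matrix.one_mulVec, dotProduct_sub, h2]
  unfold facePrecisionForm
  rw [← Finset.sum_coe_sort S]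
  simp only [extendByZero_apply_mem, sum_unitSteps_eq_sum_ite, hR, Finset.sum_sub_distrib]
  congr 1
  simp [dotProduct, sq]

/-- A sum over a finite set of faces of a function vanishing off `S` and off that set is the sum
over `S`. [folklore] -/
theorem sum_eq_sum_coe_of_vanishing (T : Finset (Site 2)) (φ : Site 2 → ℝ)
    (hT : ∀ f ∉ T, φ f = 0) (hS : ∀ f ∉ S, φ f = 0) : ∑ f ∈ T, φ f = ∑ i : S, φ i := by
  calc ∑ f ∈ T, φ f = ∑ f ∈ T ∩ S, φ f :=
        (Finset.sum_subset Finset.inter_subset_left fun f hfT hfn =>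
          hS f fun hfS => hfn (Finset.mem_inter.2 ⟨hfT, hfS⟩)).symm
    _ = ∑ f ∈ S, φ f :=
        Finset.sum_subset Finset.inter_subset_right fun f hfS hfn =>
          hT f fun hfT => hfn (Finset.mem_inter.2 ⟨hfT, hfS⟩)
    _ = ∑ i : S, φ i := (Finset.sum_coe_sort S φ).symm

/-- **The covariance form of a finitely supported test vector**: `Σ_{f,g ∈ supp t} t_f t_g G_S(f,g)`
is the quadratic form of the Green matrix at `t|_S` (terms off `S` vanish). [folklore] -/
theorem sum_sum_faceGreen_eq_dotProduct (t : Site 2 →₀ ℝ) :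
    ∑ f ∈ t.support, ∑ g ∈ t.support, t f * t g * faceGreen ↑S f g =
      (fun i : S => t i) ⬝ᵥ faceGreenMatrix S *ᵥ fun i : S => t i := by
  have hin : ∀ f : Site 2, ∑ g ∈ t.support, t f * t g * faceGreen ↑S f g =
      ∑ j : S, t f * t j * faceGreen ↑S f j := fun f =>
    sum_eq_sum_coe_of_vanishing S t.support (fun g => t f * t g * faceGreen ↑S f g)
      (fun g hg => by rw [Finsupp.notMem_support_iff.1 hg, mul_zero, zero_mul])
      (fun g hg => by rw [faceGreen_eq_zero_of_not_mem_right f (by rwa [Finset.mem_coe]), mul_zero])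
  simp only [hin]
  rw [sum_eq_sum_coe_of_vanishing S t.support (fun f => ∑ j : S, t f * t j * faceGreen ↑S f j)
    (fun f hf => Finset.sum_eq_zero fun j _ => by
      rw [Finsupp.notMem_support_iff.1 hf, zero_mul, zero_mul])
    (fun f hf => Finset.sum_eq_zero fun j _ => by
      rw [faceGreen_eq_zero_of_not_mem_left (by rwa [Finset.mem_coe]) _, mul_zero])]
  simp only [dotProduct, Matrix.mulVec, faceGreenMatrix_apply, Finset.mul_sum]
  exact Finset.sum_congr rfl fun i _ => Finset.sum_congr rfl fun j _ => by ring

/-- **The Green function of a finite face set is a positive semidefinite kernel**: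
`Σ_{f,g} t_f t_g G_A(f,g) ≥ 0` for every finitely supported `t` ("covariance PSD").
[cite: Lawler1991, §1.5] -/
theorem sum_sum_faceGreen_nonneg {A : Set (Site 2)} (hA : A.Finite) (t : Site 2 →₀ ℝ) :
    0 ≤ ∑ f ∈ t.support, ∑ g ∈ t.support, t f * t g * faceGreen A f g := by
  obtain ⟨S, rfl⟩ : ∃ S : Finset (Site 2), (S : Set (Site 2)) = A := ⟨hA.toFinset, hA.coe_toFinset⟩
  rw [sum_sum_faceGreen_eq_dotProduct]
  have h := (posSemidef_faceGreenMatrix S).dotProduct_mulVec_nonneg (fun i : S => t i)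
  rwa [star_trivial] at h

/-! ### The law as an image of Mathlib's multivariate Gaussian -/

/-- Extension by zero is measurable (product σ-algebras). [folklore] -/
theorem measurable_extendByZero : Measurable (extendByZero S) := by
  refine measurable_pi_lambda _ fun f => ?_
  by_cases hf : f ∈ S
  · simp only [extendByZero, hf, dif_pos]
    exact measurable_pi_apply _
  · simp only [extendByZero, hf, dif_neg, not_false_eq_true]
    exact measurable_const

/-- Extension by zero from Euclidean `ℝ^S` is measurable. [folklore] -/
theorem measurable_extendByZero_ofLp :
    Measurable fun y : EuclideanSpace ℝ S => extendByZero S (ofLp y) :=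
  (measurable_extendByZero S).comp (WithLp.measurable_ofLp 2 _)

/-- The density of `faceDGFF` is the Gaussian weight of the precision matrix `I − P_S`, transported
to `ℝ^S`. [folklore] -/
theorem faceDensity_eq_gaussWeight (x : S → ℝ) :
    ENNReal.ofReal (Real.exp (-(facePrecisionForm S (extendByZero S x)) / 2)) =
      gaussWeight (1 - faceTransition S) (toLp 2 x) := by
  rw [gaussWeight, ofLp_toLp, facePrecisionForm_extendByZero]

/-- **The face DGFF is a multivariate Gaussian**: for a finite face set, `faceDGFF Ω δ` is the image
of Mathlib's `multivariateGaussian 0 G` on `ℝ^{Fc}`, `G = faceGreenMatrix` the (positive definite)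
Green matrix of `Fc = faceDomain Ω δ`, under extension by zero. [cite: SchrammSheffield2009, §1.3] -/
theorem faceDGFF_eq_map_multivariateGaussian {Ω : Set ℂ} {δ : ℝ} (hfin : (faceDomain Ω δ).Finite) :
    faceDGFF Ω δ = (multivariateGaussian 0 (faceGreenMatrix hfin.toFinset)).map
      (fun y => extendByZero hfin.toFinset (ofLp y)) := by
  unfold faceDGFF
  rw [dif_pos hfin]
  dsimp only
  set S := hfin.toFinset with hS
  set w : (S → ℝ) → ℝ≥0∞ := fun x =>
    ENNReal.ofReal (Real.exp (-(facePrecisionForm S (extendByZero S x)) / 2)) with hw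
  have hP : (1 - faceTransition S).PosDef := posDef_one_sub_faceTransition S
  obtain ⟨hT, hZ0, hZtop⟩ := multivariateGaussian_inv_eq_withDensity hP
  rw [← faceGreenMatrix_eq_inv] at hT
  -- the density of `faceDGFF` is the transported Gaussian weight
  have hwg : w = gaussWeight (1 - faceTransition S) ∘ toLp 2 := funext (faceDensity_eq_gaussWeight S)
  set e : EuclideanSpace ℝ S ≃ᵐ (S → ℝ) := (MeasurableEquiv.toLp 2 (S → ℝ)).symm with he
  have hecoe : (e : EuclideanSpace ℝ S → (S → ℝ)) = ofLp := rfl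
  have hesymm : (e.symm : (S → ℝ) → EuclideanSpace ℝ S) = toLp 2 := rfl
  have hvol : (volume : Measure (EuclideanSpace ℝ S)).map e = volume := by
    rw [hecoe]; exact (PiLp.volume_preserving_ofLp S).map_eq
  -- transport of the Gaussian along `ofLp : ℝ^S ≃ (S → ℝ)`
  have hmap : (multivariateGaussian 0 (faceGreenMatrix S)).map ofLp =
      (gaussZ (1 - faceTransition S))⁻¹ • (volume : Measure (S → ℝ)).withDensity w := by
    rw [hT, Measure.map_smul, ← hecoe, map_withDensity_equiv, hvol, hesymm, hwg]
  have hZ : gaussZ (1 - faceTransition S) = (volume : Measure (S → ℝ)).withDensity w Set.univ := by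
    rw [withDensity_apply _ MeasurableSet.univ, Measure.restrict_univ, gaussZ, hwg]
    exact ((PiLp.volume_preserving_toLp S).lintegral_comp (measurable_gaussWeight _)).symm
  have hfun : (fun y : EuclideanSpace ℝ S => extendByZero S (ofLp y)) = extendByZero S ∘ ofLp := rfl
  rw [hfun, ← Measure.map_map (measurable_extendByZero S) (WithLp.measurable_ofLp 2 _), hmap, hZ]

/-! ### Consequences: probability, support, mean, characteristic functional, covariance -/

/-- **The face DGFF is a probability measure** — for a finite face set as the image of a Gaussian
probability measure, otherwise as the documented junk value `δ_0` of `faceDGFF`.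
[cite: SchrammSheffield2009, §1.3] -/
theorem isProbabilityMeasure_faceDGFF (Ω : Set ℂ) (δ : ℝ) : IsProbabilityMeasure (faceDGFF Ω δ) := by
  by_cases hfin : (faceDomain Ω δ).Finite
  · rw [faceDGFF_eq_map_multivariateGaussian hfin]
    exact Measure.isProbabilityMeasure_map (measurable_extendByZero_ofLp _).aemeasurable
  · rw [faceDGFF_of_infinite hfin]
    infer_instance

/-- **The field vanishes off the face domain**: for `f ∉ faceDomain Ω δ`, `h f = 0` almost surely
(indeed surely on the range of the extension by zero). [cite: SchrammSheffield2009, §1.3] -/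
theorem faceDGFF_eval_ne_zero {Ω : Set ℂ} {δ : ℝ} {f : Site 2} (hf : f ∉ faceDomain Ω δ) :
    faceDGFF Ω δ {h | h f ≠ 0} = 0 := by
  have hms : MeasurableSet {h : Site 2 → ℝ | h f ≠ 0} :=
    (measurableSet_eq_fun (measurable_pi_apply f) measurable_const).compl
  by_cases hfin : (faceDomain Ω δ).Finite
  · have hfS : f ∉ hfin.toFinset := fun h => hf (hfin.mem_toFinset.1 h)
    rw [faceDGFF_eq_map_multivariateGaussian hfin, Measure.map_apply (measurable_extendByZero_ofLp _) hms]
    have : (fun y : EuclideanSpace ℝ hfin.toFinset => extendByZero hfin.toFinset (ofLp y)) ⁻¹'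
        {h : Site 2 → ℝ | h f ≠ 0} = ∅ := by
      ext y
      simp [extendByZero_of_not_mem _ hfS]
    rw [this, measure_empty]
  · rw [faceDGFF_of_infinite hfin, Measure.dirac_apply' _ hms]
    simp

/-- Integration against the face DGFF is integration against the multivariate Gaussian of the
Green matrix, composed with extension by zero. [cite: SchrammSheffield2009, §1.3] -/
theorem integral_faceDGFF_eq {Ω : Set ℂ} {δ : ℝ} (hfin : (faceDomain Ω δ).Finite)
    {E : Type*} [NormedAddCommGroup E] [NormedSpace ℝ E] {F : (Site 2 → ℝ) → E}
    (hF : AEStronglyMeasurable F (faceDGFF Ω δ)) :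
    ∫ h, F h ∂faceDGFF Ω δ =
      ∫ y, F (extendByZero hfin.toFinset (ofLp y)) ∂multivariateGaussian 0 (faceGreenMatrix hfin.toFinset) := by
  rw [faceDGFF_eq_map_multivariateGaussian hfin] at hF ⊢
  exact integral_map (measurable_extendByZero_ofLp _).aemeasurable hF

/-- The coordinates of Mathlib's centred multivariate Gaussian have mean zero. [folklore] -/
theorem integral_eval_multivariateGaussian_zero {G : Matrix S S ℝ} (hG : G.PosSemidef) (i : S) :
    ∫ y, (y : EuclideanSpace ℝ S) i ∂multivariateGaussian 0 G = 0 := by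
  have hmp := measurePreserving_eval_multivariateGaussian (μ := (0 : EuclideanSpace ℝ S)) hG (i := i)
  calc ∫ y, (y : EuclideanSpace ℝ S) i ∂multivariateGaussian 0 G
      = ∫ r, r ∂(multivariateGaussian 0 G).map (fun y : EuclideanSpace ℝ S => y i) :=
        (integral_map hmp.measurable.aemeasurable aestronglyMeasurable_id).symm
    _ = 0 := by rw [hmp.map_eq, integral_id_gaussianReal]; rfl

/-- **The face DGFF is centred**: `E[h_f] = 0`. [cite: SchrammSheffield2009, §1.3] -/
theorem integral_eval_faceDGFF {Ω : Set ℂ} {δ : ℝ} (hfin : (faceDomain Ω δ).Finite) (f : Site 2) :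
    ∫ h, h f ∂faceDGFF Ω δ = 0 := by
  rw [integral_faceDGFF_eq hfin (measurable_pi_apply f).aestronglyMeasurable]
  by_cases hf : f ∈ hfin.toFinset
  · simp only [extendByZero_apply_of_mem _ hf]
    exact integral_eval_multivariateGaussian_zero _ (posSemidef_faceGreenMatrix _) ⟨f, hf⟩
  · simp [extendByZero_of_not_mem _ hf]

/-- **Covariance of the face DGFF**: `E[h_f h_g] = G_{Fc}(f, g)`, the Green function of the walk
killed off the face domain (both sides vanish unless `f, g ∈ Fc`). [cite: SchrammSheffield2009, §1.3] -/
theorem integral_mul_eval_faceDGFF {Ω : Set ℂ} {δ : ℝ} (hfin : (faceDomain Ω δ).Finite)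
    (f g : Site 2) : ∫ h, h f * h g ∂faceDGFF Ω δ = faceGreen (faceDomain Ω δ) f g := by
  rw [integral_faceDGFF_eq hfin (F := fun h : Site 2 → ℝ => h f * h g)
    ((measurable_pi_apply f).mul (measurable_pi_apply g)).aestronglyMeasurable]
  set S := hfin.toFinset with hS
  have hSc : (S : Set (Site 2)) = faceDomain Ω δ := hfin.coe_toFinset
  have hG : ∀ a b : Site 2, faceGreen (faceDomain Ω δ) a b = faceGreen ↑S a b := fun a b => by
    rw [hSc]
  rw [hG]
  by_cases hf : f ∈ S
  swap
  · rw [faceGreen_eq_zero_of_not_mem_left (by rwa [Finset.mem_coe]) g]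
    simp [extendByZero_of_not_mem _ hf]
  by_cases hg : g ∈ S
  swap
  · rw [faceGreen_eq_zero_of_not_mem_right f (by rwa [Finset.mem_coe])]
    simp [extendByZero_of_not_mem _ hg]
  simp only [extendByZero_apply_of_mem _ hf, extendByZero_apply_of_mem _ hg]
  have hcov := covariance_eval_multivariateGaussian (μ := (0 : EuclideanSpace ℝ S))
    (posSemidef_faceGreenMatrix S) ⟨f, hf⟩ ⟨g, hg⟩
  rw [covariance] at hcov
  simp only [integral_eval_multivariateGaussian_zero S (posSemidef_faceGreenMatrix S), sub_zero,
    faceGreenMatrix_apply] at hcov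
  exact hcov

/-- **The characteristic functional of the face DGFF** — the clause `gff` of the cruxes of route
`SAWDiscreteFlowLine`: for a finite face set, `faceDGFF Ω δ` is a probability measure with
`E exp(i Σ_f t_f h_f) = exp(−½ Σ_{f,g} t_f t_g G_{Fc}(f,g))` for every finitely supported `t`, i.e.
`IsFaceDGFFLaw Ω δ (faceDGFF Ω δ)`; in particular the hypothesis `gff δ (P δ)` of those cruxes is
satisfiable. (Gaussian characteristic function, Mathlib `charFun_multivariateGaussian`, transported
along extension by zero.) [cite: SchrammSheffield2009, §1.3] -/
theorem isFaceDGFFLaw_faceDGFF {Ω : Set ℂ} {δ : ℝ} (hfin : (faceDomain Ω δ).Finite) :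
    IsFaceDGFFLaw Ω δ (faceDGFF Ω δ) := by
  refine ⟨isProbabilityMeasure_faceDGFF Ω δ, fun t => ?_⟩
  have hFm : Measurable fun h : Site 2 → ℝ =>
      Complex.exp (Complex.I * ((∑ f ∈ t.support, t f * h f : ℝ) : ℂ)) := by
    refine Complex.measurable_exp.comp (Measurable.const_mul (Complex.measurable_ofReal.comp ?_) _)
    exact Finset.measurable_sum _ fun f _ => (measurable_pi_apply f).const_mul _
  rw [integral_faceDGFF_eq hfin hFm.aestronglyMeasurable]
  set S := hfin.toFinset with hS
  have hSc : (S : Set (Site 2)) = faceDomain Ω δ := hfin.coe_toFinset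
  have hG : ∀ a b : Site 2, faceGreen (faceDomain Ω δ) a b = faceGreen ↑S a b := fun a b => by
    rw [hSc]
  simp only [hG]
  -- the coefficient vector
  set v : EuclideanSpace ℝ S := toLp 2 fun i : S => t (i : Site 2) with hv
  have hlin : ∀ y : EuclideanSpace ℝ S,
      (∑ f ∈ t.support, t f * extendByZero S (ofLp y) f) = inner ℝ y v := by
    intro y
    rw [sum_eq_sum_coe_of_vanishing S t.support (fun f => t f * extendByZero S (ofLp y) f)
      (fun f hf => by rw [Finsupp.notMem_support_iff.1 hf, zero_mul])
      (fun f hf => by rw [extendByZero_of_not_mem _ hf, mul_zero]),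
      EuclideanSpace.inner_eq_star_dotProduct, star_trivial]
    simp only [extendByZero_apply_mem, dotProduct, hv, ofLp_toLp]
  have hquad : ofLp v ⬝ᵥ faceGreenMatrix S *ᵥ ofLp v =
      ∑ f ∈ t.support, ∑ g ∈ t.support, t f * t g * faceGreen ↑S f g := by
    rw [sum_sum_faceGreen_eq_dotProduct, hv, ofLp_toLp]
  have hcf := charFun_multivariateGaussian (μ := (0 : EuclideanSpace ℝ S)) (posSemidef_faceGreenMatrix S) v
  rw [charFun_apply, inner_zero_right] at hcf
  have hint : (fun y : EuclideanSpace ℝ S =>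
      Complex.exp (Complex.I * ((∑ f ∈ t.support, t f * extendByZero S (ofLp y) f : ℝ) : ℂ))) =
      fun y => Complex.exp ((inner ℝ y v : ℂ) * Complex.I) := by
    funext y
    rw [hlin y, mul_comm]
  rw [hint, hcf, hquad]
  congr 1
  push_cast
  ring

/-! ### Uniqueness: the characteristic functional pins the law down -/

/-- **Finite-dimensional characteristic functionals determine a finite measure on `ℝ^{ℤ²}`**
(product σ-algebra): if `∫ e^{i Σ_f t_f h_f} dμ = ∫ e^{i Σ_f t_f h_f} dν` for every finitely
supported `t`, then `μ = ν` — the marginals on every finite set of coordinates have the same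
characteristic function (Mathlib `Measure.ext_of_charFun` on Euclidean `ℝ^J`), and a measure on
the product space is determined by its finite-dimensional marginals (Mathlib
`IsProjectiveLimit.unique`). [folklore] -/
theorem measure_eq_of_integral_exp_sum_eq {μ ν : Measure (Site 2 → ℝ)} [IsFiniteMeasure μ]
    [IsFiniteMeasure ν]
    (h : ∀ t : Site 2 →₀ ℝ,
      ∫ x, Complex.exp (Complex.I * ((∑ f ∈ t.support, t f * x f : ℝ) : ℂ)) ∂μ =
        ∫ x, Complex.exp (Complex.I * ((∑ f ∈ t.support, t f * x f : ℝ) : ℂ)) ∂ν) :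
    μ = ν := by
  refine IsProjectiveLimit.unique (P := fun J : Finset (Site 2) => ν.map J.restrict)
    (fun J => ?_) (fun J => rfl)
  set e : (J → ℝ) ≃ᵐ EuclideanSpace ℝ J := MeasurableEquiv.toLp 2 (J → ℝ) with he
  have hmJ : Measurable (J.restrict : (Site 2 → ℝ) → (J → ℝ)) :=
    measurable_pi_lambda _ fun j => measurable_pi_apply _
  suffices hE : (μ.map J.restrict).map e = (ν.map J.restrict).map e by
    have h2 := congrArg (fun ρ : Measure (EuclideanSpace ℝ J) => ρ.map e.symm) hE
    simpa only [MeasurableEquiv.map_symm_map] using h2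
  apply Measure.ext_of_charFun
  funext v
  have hFm : Measurable fun y : EuclideanSpace ℝ J => Complex.exp ((inner ℝ y v : ℂ) * Complex.I) :=
    (Complex.continuous_exp.comp ((Complex.continuous_ofReal.comp
      (continuous_id.inner continuous_const)).mul continuous_const)).measurable
  rw [Measure.map_map e.measurable hmJ, Measure.map_map e.measurable hmJ, charFun_apply, charFun_apply,
    integral_map (e.measurable.comp hmJ).aemeasurable hFm.aestronglyMeasurable,
    integral_map (e.measurable.comp hmJ).aemeasurable hFm.aestronglyMeasurable]
  -- the test vector `v` as a finitely supported function on `ℤ²`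
  set t : Site 2 →₀ ℝ := Finsupp.onFinset J (fun f => if hf : f ∈ J then v ⟨f, hf⟩ else 0)
    (fun f hf => by by_contra hfJ; exact hf (dif_neg hfJ)) with ht
  have hts : t.support ⊆ J := Finsupp.support_onFinset_subset
  have hsum : ∀ x : Site 2 → ℝ, (∑ f ∈ t.support, t f * x f) = inner ℝ (e (J.restrict x)) v := by
    intro x
    rw [Finset.sum_subset hts (fun f _ hft => by rw [Finsupp.notMem_support_iff.1 hft, zero_mul]),
      ← Finset.sum_coe_sort J, he, MeasurableEquiv.toLp_apply, EuclideanSpace.inner_eq_star_dotProduct,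
      star_trivial, ofLp_toLp]
    simp only [dotProduct, Finset.restrict, ht, Finsupp.onFinset_apply, Finset.coe_mem, dif_pos]
  have hint : ∀ ρ : Measure (Site 2 → ℝ),
      ∫ x, Complex.exp ((inner ℝ (e (J.restrict x)) v : ℂ) * Complex.I) ∂ρ =
        ∫ x, Complex.exp (Complex.I * ((∑ f ∈ t.support, t f * x f : ℝ) : ℂ)) ∂ρ := fun ρ =>
    integral_congr_ae (ae_of_all _ fun x => by dsimp only; rw [hsum x, mul_comm])
  exact (hint μ).trans ((h t).trans (hint ν).symm)

/-- **The face-DGFF law is unique**: for a finite face set, a measure satisfies the characteristic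
functional clause `IsFaceDGFFLaw Ω δ` (the `gff` hypothesis of the cruxes of route
`SAWDiscreteFlowLine`) iff it IS `faceDGFF Ω δ`. [cite: SchrammSheffield2009, §1.3] -/
theorem isFaceDGFFLaw_iff {Ω : Set ℂ} {δ : ℝ} (hfin : (faceDomain Ω δ).Finite)
    {μ : Measure (Site 2 → ℝ)} : IsFaceDGFFLaw Ω δ μ ↔ μ = faceDGFF Ω δ := by
  refine ⟨fun hμ => ?_, fun h => h ▸ isFaceDGFFLaw_faceDGFF hfin⟩
  haveI := hμ.isProbabilityMeasure
  haveI := isProbabilityMeasure_faceDGFF Ω δ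
  exact measure_eq_of_integral_exp_sum_eq fun t => by rw [hμ.2 t, (isFaceDGFFLaw_faceDGFF hfin).2 t]

end Literature.Probability.RandomPlanarGeometry
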